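import Literature.MathematicalPhysics.QuantumLattice.LiebMattisSectorPF
import Literature.MathematicalPhysics.QuantumLattice.XYOrderGDProofs
import HarnessLib

/-!
# Ladder algebra of the Penrose–Onsager insertion: helper for stub `stub_poExcessBudget` of line
# `cosh-budget-penrose-onsager`, crux `BECStronglyRayleigh.InsertionFieldDelocalisation`
# (stmt-AtomisticToContinuum-9673)

Supports (does not close) stmt-AtomisticToContinuum-9673. For the `Δ = 0` XXZ (= XY) Hamiltonian
`H = J Σ_{xy ∈ E(G)} (SˣSˣ + SʸSʸ)_{xy}` of spin `n/2` on any finite graph and the total ladder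
operators `Ŝ⁺ = Σ_x S⁺_x` (the Penrose–Onsager zero-momentum creation operator `A†` when
occupied = spin up) and `Ŝ⁻ = (Ŝ⁺)†`:

* `cb4ex_pair_sum_onSite_commutator` : `[a_x b_y, Σ_w c_w] = [a,c]_x b_y + a_x [b,c]_y` (Leibniz);
* `cb4ex_xyBond_eq_ladder` : `(SˣSˣ + SʸSʸ)_{xy} = ½ (S⁺_x S⁻_y + S⁻_x S⁺_y)` (`x ≠ y`);
* `cb4ex_xyBond_commutator_raise` : `[(SˣSˣ + SʸSʸ)_{xy}, Ŝ⁺] = -(S⁺_x Sᶻ_y + Sᶻ_x S⁺_y)`, and summed,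
  `cb4ex_commutator_raise` : `[H, Ŝ⁺] = -J Σ_{xy} (S⁺_x Sᶻ_y + Sᶻ_x S⁺_y)` — for hard-core bosons on a
  `6`-regular graph this is the Penrose–Onsager handle `[H, A†] = -3A† + Σ_x a†_x m_x`;
* `cb4ex_xyBond_double_commutator` : `[Ŝ⁻, [(SˣSˣ + SʸSʸ)_{xy}, Ŝ⁺]] = 4 Sᶻ_x Sᶻ_y - 2(SˣSˣ + SʸSʸ)_{xy}`;
* `cb4ex_double_commutator` : **the f-sum rule** `[Ŝ⁻, [H, Ŝ⁺]] = 4J Σ_{xy} Sᶻ_x Sᶻ_y - 2H`;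
* `cb4ex_insertion_removal_identity` : for an eigenvector `Hψ = Eψ`, the exact identity
  `⟨Ŝ⁺ψ, H Ŝ⁺ψ⟩ + ⟨Ŝ⁻ψ, H Ŝ⁻ψ⟩ = E (‖Ŝ⁺ψ‖² + ‖Ŝ⁻ψ‖²) + 4J ⟨ψ, Σ Sᶻ_x Sᶻ_y ψ⟩ - 2E ‖ψ‖²`
  coupling the variational energies of the Penrose–Onsager insertion `A†ψ` and removal `Aψ`.

All statements are finite-dimensional matrix algebra. [folklore]
-/

noncomputable section

namespace Summit.AtomisticToContinuum.BoseEinsteinCondensation.Cruxes.InsertionFieldDelocalisation.CoshBudgetPenroseOnsager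

open scoped BigOperators ComplexOrder
open Literature.MathematicalPhysics.QuantumLattice Literature.Probability.LatticeModels Matrix Finset Complex

variable {Λ : Type*} [Fintype Λ] [DecidableEq Λ]

/-! ### Commutators of single-site products with a sum of single-site operators -/

/-- A single-site operator commutes with a single-site operator at another site and has the
on-site commutator at the same site: `a_x c_w - c_w a_x = [w = x] [a, c]_x`. [folklore] -/
theorem cb4ex_onSite_commutator_onSite {q : ℕ} (x w : Λ) (a c : Matrix (Fin q) (Fin q) ℂ) :
    (onSite x a * onSite w c - onSite w c * onSite x a : Op Λ q) =
      if w = x then onSite x (a * c - c * a) else 0 := by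
  split_ifs with hw
  · subst hw
    rw [onSite_mul, onSite_mul, onSite_sub']
  · rw [onSite_mul_onSite_comm (Ne.symm hw), sub_self]

/-- **Commutator of a two-site product with a sum of single-site operators** (Leibniz rule):
`[a_x b_y, Σ_w c_w] = [a, c]_x b_y + a_x [b, c]_y`. [folklore] -/
theorem cb4ex_pair_sum_onSite_commutator {q : ℕ} (x y : Λ) (a b c : Matrix (Fin q) (Fin q) ℂ) :
    ((onSite x a * onSite y b) * (∑ w, onSite w c) - (∑ w, onSite w c) * (onSite x a * onSite y b) :
        Op Λ q) =
      onSite x (a * c - c * a) * onSite y b + onSite x a * onSite y (b * c - c * b) := by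
  have key : ∀ w : Λ, ((onSite x a * onSite y b) * onSite w c - onSite w c * (onSite x a * onSite y b) :
      Op Λ q) =
      (if w = x then onSite x (a * c - c * a) * onSite y b else 0) +
        (if w = y then onSite x a * onSite y (b * c - c * b) else 0) := by
    intro w
    have h1 := cb4ex_onSite_commutator_onSite x w a c
    have h2 := cb4ex_onSite_commutator_onSite y w b c
    have halg : ((onSite x a * onSite y b) * onSite w c - onSite w c * (onSite x a * onSite y b) :
        Op Λ q) =
        (onSite x a * onSite w c - onSite w c * onSite x a) * onSite y b +
          onSite x a * (onSite y b * onSite w c - onSite w c * onSite y b) := by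
      noncomm_ring
    rw [halg, h1, h2]
    split_ifs <;> simp
  rw [Finset.mul_sum, Finset.sum_mul, ← Finset.sum_sub_distrib, Finset.sum_congr rfl fun w _ => key w,
    Finset.sum_add_distrib, Finset.sum_ite_eq' Finset.univ x, Finset.sum_ite_eq' Finset.univ y,
    if_pos (Finset.mem_univ x), if_pos (Finset.mem_univ y)]

/-! ### The XY bond in terms of ladder operators -/

/-- For distinct sites a bond operator is the plain product: `spinBond α x y = S^α_x S^α_y`.
[folklore] -/
theorem cb4ex_spinBond_eq_mul (n : ℕ) (α : Fin 3) {x y : Λ} (hxy : x ≠ y) :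
    (spinBond n α x y : Op Λ (n + 1)) = onSite x (spinVec n α) * onSite y (spinVec n α) := by
  unfold spinBond siteSpin
  rw [onSite_mul_onSite_comm (Ne.symm hxy), ← two_smul ℂ, smul_smul]
  norm_num

/-- **The XY bond in ladder form**: `(SˣSˣ + SʸSʸ)_{xy} = ½ (S⁺_x S⁻_y + S⁻_x S⁺_y)` for `x ≠ y`.
[folklore] -/
theorem cb4ex_xyBond_eq_ladder (n : ℕ) {x y : Λ} (hxy : x ≠ y) :
    (spinBond n 0 x y + spinBond n 1 x y : Op Λ (n + 1)) =
      (1 / 2 : ℂ) • (onSite x (spinRaise n) * onSite y (spinLower n) +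
        onSite x (spinLower n) * onSite y (spinRaise n)) := by
  -- adapted from `LiebMattis.spinDot_eq_of_ne` (Literature/…/LiebMattisMatrixElements.lean)
  have hP : (onSite x (spinX n) : Op Λ (n + 1)) =
      (1 / 2 : ℂ) • (onSite x (spinRaise n) + onSite x (spinLower n)) := by
    rw [spinX, onSite_smul', onSite_add']
  have hP' : (onSite y (spinX n) : Op Λ (n + 1)) =
      (1 / 2 : ℂ) • (onSite y (spinRaise n) + onSite y (spinLower n)) := by
    rw [spinX, onSite_smul', onSite_add']
  have hQ : (onSite x (spinY n) : Op Λ (n + 1)) =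
      (1 / (2 * I) : ℂ) • (onSite x (spinRaise n) - onSite x (spinLower n)) := by
    rw [spinY, onSite_smul', onSite_sub']
  have hQ' : (onSite y (spinY n) : Op Λ (n + 1)) =
      (1 / (2 * I) : ℂ) • (onSite y (spinRaise n) - onSite y (spinLower n)) := by
    rw [spinY, onSite_smul', onSite_sub']
  rw [cb4ex_spinBond_eq_mul n 0 hxy, cb4ex_spinBond_eq_mul n 1 hxy, spinVec_zero, spinVec_one, hP, hP',
    hQ, hQ', smul_mul_smul_comm, smul_mul_smul_comm, one_div_two_mul_I_mul_self]
  simp only [mul_add, add_mul, mul_sub, sub_mul, smul_add, smul_sub, neg_smul]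
  module

/-! ### Single and double commutators of one bond with the total ladder operators -/

/-- **`[(SˣSˣ + SʸSʸ)_{xy}, Ŝ⁺] = -(S⁺_x Sᶻ_y + Sᶻ_x S⁺_y)`** (`x ≠ y`): the hopping term does
not conserve the zero-momentum insertion; the defect is the insertion weighted by the
neighbour's `Sᶻ`. [folklore] -/
theorem cb4ex_xyBond_commutator_raise (n : ℕ) {x y : Λ} (hxy : x ≠ y) :
    ((spinBond n 0 x y + spinBond n 1 x y) * (∑ w, onSite w (spinRaise n)) -
        (∑ w, onSite w (spinRaise n)) * (spinBond n 0 x y + spinBond n 1 x y) : Op Λ (n + 1)) =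
      -(onSite x (spinRaise n) * onSite y (SpinOperators.spinZ n) +
        onSite x (SpinOperators.spinZ n) * onSite y (spinRaise n)) := by
  have hLR : spinLower n * spinRaise n - spinRaise n * spinLower n =
      -((2 : ℂ) • SpinOperators.spinZ n) := by
    rw [← spinRaise_commutator_spinLower, neg_sub]
  rw [cb4ex_xyBond_eq_ladder n hxy, smul_mul_assoc, mul_smul_comm, ← smul_sub, add_mul, mul_add,
    add_sub_add_comm, cb4ex_pair_sum_onSite_commutator x y, cb4ex_pair_sum_onSite_commutator x y,
    sub_self, hLR]
  simp only [onSite_zero, mul_zero, zero_mul, add_zero, zero_add, onSite_neg', onSite_smul', mul_neg,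
    neg_mul, smul_mul_assoc, mul_smul_comm, smul_add, smul_neg, smul_smul]
  norm_num
  abel

/-- **`[Ŝ⁻, [(SˣSˣ + SʸSʸ)_{xy}, Ŝ⁺]] = 4 Sᶻ_x Sᶻ_y - 2 (SˣSˣ + SʸSʸ)_{xy}`** (`x ≠ y`).
[folklore] -/
theorem cb4ex_xyBond_double_commutator (n : ℕ) {x y : Λ} (hxy : x ≠ y) :
    ((∑ w, onSite w (spinLower n)) *
          ((spinBond n 0 x y + spinBond n 1 x y) * (∑ w, onSite w (spinRaise n)) -
            (∑ w, onSite w (spinRaise n)) * (spinBond n 0 x y + spinBond n 1 x y)) -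
        ((spinBond n 0 x y + spinBond n 1 x y) * (∑ w, onSite w (spinRaise n)) -
            (∑ w, onSite w (spinRaise n)) * (spinBond n 0 x y + spinBond n 1 x y)) *
          (∑ w, onSite w (spinLower n)) : Op Λ (n + 1)) =
      (4 : ℂ) • (onSite x (SpinOperators.spinZ n) * onSite y (SpinOperators.spinZ n)) -
        (2 : ℂ) • (spinBond n 0 x y + spinBond n 1 x y) := by
  have hRL : spinRaise n * spinLower n - spinLower n * spinRaise n = (2 : ℂ) • SpinOperators.spinZ n :=
    spinRaise_commutator_spinLower n
  have hZL : SpinOperators.spinZ n * spinLower n - spinLower n * SpinOperators.spinZ n = -spinLower n :=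
    spinZ_commutator_spinLower n
  set Lo : Op Λ (n + 1) := ∑ w, onSite w (spinLower n) with hLo
  rw [cb4ex_xyBond_commutator_raise n hxy]
  -- `Lo * (-C) - (-C) * Lo = C * Lo - Lo * C`
  have h1 : (Lo * -(onSite x (spinRaise n) * onSite y (SpinOperators.spinZ n) +
        onSite x (SpinOperators.spinZ n) * onSite y (spinRaise n)) -
      -(onSite x (spinRaise n) * onSite y (SpinOperators.spinZ n) +
        onSite x (SpinOperators.spinZ n) * onSite y (spinRaise n)) * Lo : Op Λ (n + 1)) =
      (onSite x (spinRaise n) * onSite y (SpinOperators.spinZ n) * Lo -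
          Lo * (onSite x (spinRaise n) * onSite y (SpinOperators.spinZ n))) +
        (onSite x (SpinOperators.spinZ n) * onSite y (spinRaise n) * Lo -
          Lo * (onSite x (SpinOperators.spinZ n) * onSite y (spinRaise n))) := by
    noncomm_ring
  rw [h1, hLo, cb4ex_pair_sum_onSite_commutator x y, cb4ex_pair_sum_onSite_commutator x y, hRL, hZL,
    onSite_smul', onSite_neg', onSite_neg', onSite_smul', cb4ex_xyBond_eq_ladder n hxy]
  simp only [smul_mul_assoc, mul_smul_comm, mul_neg, neg_mul, smul_add]
  module

/-! ### The single commutator `[H, Ŝ⁺]`, summed over the bonds -/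

/-- The insertion defect `S⁺_x Sᶻ_y + Sᶻ_x S⁺_y` is symmetric in the two sites. [folklore] -/
theorem cb4ex_insertionDefect_symm (n : ℕ) (x y : Λ) :
    (onSite x (spinRaise n) * onSite y (SpinOperators.spinZ n) +
        onSite x (SpinOperators.spinZ n) * onSite y (spinRaise n) : Op Λ (n + 1)) =
      onSite y (spinRaise n) * onSite x (SpinOperators.spinZ n) +
        onSite y (SpinOperators.spinZ n) * onSite x (spinRaise n) := by
  rcases eq_or_ne x y with rfl | hxy
  · rfl
  · rw [onSite_mul_onSite_comm hxy, onSite_mul_onSite_comm hxy]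
    exact add_comm _ _

/-- **`[H, A†]` for the XY model**: `[H, Ŝ⁺] = -J Σ_{xy ∈ E(G)} (S⁺_x Sᶻ_y + Sᶻ_x S⁺_y)` for
`H = xxzHamiltonian n G J 0` on any finite graph. For hard-core bosons (`n = 1`, `J = -1`,
`Sᶻ = n̂ - ½`) on a `6`-regular graph this is the Penrose–Onsager handle
`[H, A†] = -3A† + Σ_x a†_x m_x`, `m_x` the number of occupied neighbours of `x`. [folklore] -/
theorem cb4ex_commutator_raise (n : ℕ) (G : SimpleGraph Λ) [DecidableRel G.Adj] (J : ℝ) :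
    (xxzHamiltonian n G J 0 * (totalSpin n 0 + I • totalSpin n 1) -
        (totalSpin n 0 + I • totalSpin n 1) * xxzHamiltonian n G J 0 : Op Λ (n + 1)) =
      (-(J : ℂ)) • ∑ e ∈ G.edgeFinset,
        Sym2.lift ⟨fun x y => onSite x (spinRaise n) * onSite y (SpinOperators.spinZ n) +
          onSite x (SpinOperators.spinZ n) * onSite y (spinRaise n), cb4ex_insertionDefect_symm n⟩ e := by
  rw [LiebMattis.totalSpin_raise_eq_sum_onSite]
  set P : Op Λ (n + 1) := ∑ w, onSite w (spinRaise n) with hP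
  have hlin : ∀ (s : Finset (Sym2 Λ)) (f : Sym2 Λ → Op Λ (n + 1)),
      (∑ e ∈ s, f e) * P - P * ∑ e ∈ s, f e = ∑ e ∈ s, (f e * P - P * f e) := by
    intro s f
    simp only [Finset.sum_mul, Finset.mul_sum, ← Finset.sum_sub_distrib]
  have hedge : ∀ e ∈ G.edgeFinset,
      (Sym2.lift ⟨fun x y => spinBond n 0 x y + spinBond n 1 x y + ((0 : ℝ) : ℂ) • spinBond n 2 x y,
          fun x y => by simp only [spinBond_comm]⟩ e) * P -
        P * Sym2.lift ⟨fun x y => spinBond n 0 x y + spinBond n 1 x y + ((0 : ℝ) : ℂ) • spinBond n 2 x y,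
          fun x y => by simp only [spinBond_comm]⟩ e =
      -Sym2.lift ⟨fun x y => onSite x (spinRaise n) * onSite y (SpinOperators.spinZ n) +
          onSite x (SpinOperators.spinZ n) * onSite y (spinRaise n), cb4ex_insertionDefect_symm n⟩ e := by
    intro e he
    induction e using Sym2.ind with
    | h x y =>
      have hxy : x ≠ y := G.ne_of_adj (by simpa using he)
      simp only [Sym2.lift_mk, Complex.ofReal_zero, zero_smul, add_zero]
      rw [hP, cb4ex_xyBond_commutator_raise n hxy]
  rw [xxzHamiltonian, smul_mul_assoc, mul_smul_comm, ← smul_sub, hlin, Finset.sum_congr rfl hedge,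
    Finset.sum_neg_distrib, smul_neg, ← neg_smul]

/-! ### The f-sum rule: the double commutator of `H` with the total ladder operators -/

/-- **The f-sum rule for the XY model** on any finite graph, any spin and any coupling `J`:
`[Ŝ⁻, [H, Ŝ⁺]] = 4J Σ_{xy ∈ E(G)} Sᶻ_x Sᶻ_y - 2H` for `H = J Σ_{xy} (SˣSˣ + SʸSʸ)_{xy}`
(`xxzHamiltonian n G J 0`, `Ŝ^± = Ŝˣ ± iŜʸ`). [folklore] -/
theorem cb4ex_double_commutator (n : ℕ) (G : SimpleGraph Λ) [DecidableRel G.Adj] (J : ℝ) :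
    ((totalSpin n 0 - I • totalSpin n 1) *
          (xxzHamiltonian n G J 0 * (totalSpin n 0 + I • totalSpin n 1) -
            (totalSpin n 0 + I • totalSpin n 1) * xxzHamiltonian n G J 0) -
        (xxzHamiltonian n G J 0 * (totalSpin n 0 + I • totalSpin n 1) -
            (totalSpin n 0 + I • totalSpin n 1) * xxzHamiltonian n G J 0) *
          (totalSpin n 0 - I • totalSpin n 1) : Op Λ (n + 1)) =
      (4 * J : ℂ) • (∑ e ∈ G.edgeFinset,
          Sym2.lift ⟨fun x y => spinBond n 2 x y, fun x y => spinBond_comm n 2 y x⟩ e) -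
        (2 : ℂ) • xxzHamiltonian n G J 0 := by
  rw [LiebMattis.totalSpin_raise_eq_sum_onSite, LiebMattis.totalSpin_lower_eq_sum_onSite]
  set P : Op Λ (n + 1) := ∑ w, onSite w (spinRaise n) with hP
  set M : Op Λ (n + 1) := ∑ w, onSite w (spinLower n) with hM
  -- linearity of the double commutator in the middle slot
  have hlin : ∀ (s : Finset (Sym2 Λ)) (f : Sym2 Λ → Op Λ (n + 1)),
      M * ((∑ e ∈ s, f e) * P - P * ∑ e ∈ s, f e) - ((∑ e ∈ s, f e) * P - P * ∑ e ∈ s, f e) * M =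
        ∑ e ∈ s, (M * (f e * P - P * f e) - (f e * P - P * f e) * M) := by
    intro s f
    simp only [Finset.sum_mul, Finset.mul_sum, ← Finset.sum_sub_distrib]
  have hedge : ∀ e ∈ G.edgeFinset,
      M * ((Sym2.lift ⟨fun x y => spinBond n 0 x y + spinBond n 1 x y + ((0 : ℝ) : ℂ) • spinBond n 2 x y,
          fun x y => by simp only [spinBond_comm]⟩ e) * P -
          P * Sym2.lift ⟨fun x y => spinBond n 0 x y + spinBond n 1 x y + ((0 : ℝ) : ℂ) • spinBond n 2 x y,
            fun x y => by simp only [spinBond_comm]⟩ e) -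
        ((Sym2.lift ⟨fun x y => spinBond n 0 x y + spinBond n 1 x y + ((0 : ℝ) : ℂ) • spinBond n 2 x y,
          fun x y => by simp only [spinBond_comm]⟩ e) * P -
          P * Sym2.lift ⟨fun x y => spinBond n 0 x y + spinBond n 1 x y + ((0 : ℝ) : ℂ) • spinBond n 2 x y,
            fun x y => by simp only [spinBond_comm]⟩ e) * M =
      (4 : ℂ) • Sym2.lift ⟨fun x y => spinBond n 2 x y, fun x y => spinBond_comm n 2 y x⟩ e -
        (2 : ℂ) • Sym2.lift ⟨fun x y => spinBond n 0 x y + spinBond n 1 x y + ((0 : ℝ) : ℂ) • spinBond n 2 x y,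
          fun x y => by simp only [spinBond_comm]⟩ e := by
    intro e he
    induction e using Sym2.ind with
    | h x y =>
      have hxy : x ≠ y := G.ne_of_adj (by simpa using he)
      simp only [Sym2.lift_mk, Complex.ofReal_zero, zero_smul, add_zero]
      rw [hM, hP, cb4ex_xyBond_double_commutator n hxy, cb4ex_spinBond_eq_mul n 2 hxy, spinVec_two]
  rw [xxzHamiltonian, smul_mul_assoc, mul_smul_comm, ← smul_sub, mul_smul_comm, smul_mul_assoc,
    ← smul_sub, hlin, Finset.sum_congr rfl hedge, Finset.sum_sub_distrib, ← Finset.smul_sum,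
    ← Finset.smul_sum, smul_sub, smul_smul, smul_comm (J : ℂ) (2 : ℂ), mul_comm (4 : ℂ)]

/-! ### The insertion–removal identity -/

/-- `⟨ψ, Ŝ⁻ v⟩ = ⟨Ŝ⁺ ψ, v⟩` (`(Ŝ⁻)ᴴ = Ŝ⁺`). [folklore] -/
theorem cb4ex_star_dotProduct_lower_mulVec (n : ℕ) (ψ v : TensorIndex Λ (n + 1) → ℂ) :
    star ψ ⬝ᵥ (totalSpin n 0 - I • totalSpin n 1 : Op Λ (n + 1)) *ᵥ v =
      star ((totalSpin n 0 + I • totalSpin n 1 : Op Λ (n + 1)) *ᵥ ψ) ⬝ᵥ v := by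
  rw [dotProduct_mulVec, star_mulVec, LiebMattis.conjTranspose_totalSpin_raise]

/-- `⟨ψ, Ŝ⁺ v⟩ = ⟨Ŝ⁻ ψ, v⟩` (`(Ŝ⁺)ᴴ = Ŝ⁻`). [folklore] -/
theorem cb4ex_star_dotProduct_raise_mulVec (n : ℕ) (ψ v : TensorIndex Λ (n + 1) → ℂ) :
    star ψ ⬝ᵥ (totalSpin n 0 + I • totalSpin n 1 : Op Λ (n + 1)) *ᵥ v =
      star ((totalSpin n 0 - I • totalSpin n 1 : Op Λ (n + 1)) *ᵥ ψ) ⬝ᵥ v := by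
  rw [dotProduct_mulVec, star_mulVec, LiebMattis.conjTranspose_totalSpin_lower]

/-- `⟨ψ, H v⟩ = E ⟨ψ, v⟩` for an eigenvector `Hψ = Eψ` (`E` real) of the Hermitian `H`.
[folklore] -/
theorem cb4ex_star_dotProduct_xxz_mulVec (n : ℕ) (G : SimpleGraph Λ) [DecidableRel G.Adj] (J : ℝ)
    {ψ : TensorIndex Λ (n + 1) → ℂ} {E : ℝ} (hψ : xxzHamiltonian n G J 0 *ᵥ ψ = (E : ℂ) • ψ)
    (v : TensorIndex Λ (n + 1) → ℂ) :
    star ψ ⬝ᵥ xxzHamiltonian n G J 0 *ᵥ v = (E : ℂ) * (star ψ ⬝ᵥ v) := by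
  have h1 : star ψ ᵥ* xxzHamiltonian n G J 0 = star (xxzHamiltonian n G J 0 *ᵥ ψ) := by
    rw [star_mulVec, (xxzHamiltonian_isHermitian n G J 0).eq]
  rw [dotProduct_mulVec, h1, hψ, star_smul, smul_dotProduct, Complex.star_def, Complex.conj_ofReal,
    smul_eq_mul]

/-- **The insertion–removal identity.** For an eigenvector `Hψ = Eψ` of the XY Hamiltonian
`H = xxzHamiltonian n G J 0` on any finite graph, the variational energies of the Penrose–Onsager
insertion `Ŝ⁺ψ` and removal `Ŝ⁻ψ` satisfy the exact sum rule
`⟨Ŝ⁺ψ, HŜ⁺ψ⟩ + ⟨Ŝ⁻ψ, HŜ⁻ψ⟩ = E(‖Ŝ⁺ψ‖² + ‖Ŝ⁻ψ‖²) + 4J ⟨ψ, Σ_{xy} Sᶻ_xSᶻ_y ψ⟩ - 2E‖ψ‖²`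
(pair `ψ` against the f-sum rule `[Ŝ⁻, [H, Ŝ⁺]] = 4J Σ Sᶻ_xSᶻ_y - 2H`). [folklore] -/
theorem cb4ex_insertion_removal_identity (n : ℕ) (G : SimpleGraph Λ) [DecidableRel G.Adj] (J : ℝ)
    {ψ : TensorIndex Λ (n + 1) → ℂ} {E : ℝ} (hψ : xxzHamiltonian n G J 0 *ᵥ ψ = (E : ℂ) • ψ) :
    star ((totalSpin n 0 + I • totalSpin n 1 : Op Λ (n + 1)) *ᵥ ψ) ⬝ᵥ
          xxzHamiltonian n G J 0 *ᵥ ((totalSpin n 0 + I • totalSpin n 1 : Op Λ (n + 1)) *ᵥ ψ) +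
        star ((totalSpin n 0 - I • totalSpin n 1 : Op Λ (n + 1)) *ᵥ ψ) ⬝ᵥ
          xxzHamiltonian n G J 0 *ᵥ ((totalSpin n 0 - I • totalSpin n 1 : Op Λ (n + 1)) *ᵥ ψ) =
      (E : ℂ) * (star ((totalSpin n 0 + I • totalSpin n 1 : Op Λ (n + 1)) *ᵥ ψ) ⬝ᵥ
            ((totalSpin n 0 + I • totalSpin n 1 : Op Λ (n + 1)) *ᵥ ψ) +
          star ((totalSpin n 0 - I • totalSpin n 1 : Op Λ (n + 1)) *ᵥ ψ) ⬝ᵥ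
            ((totalSpin n 0 - I • totalSpin n 1 : Op Λ (n + 1)) *ᵥ ψ)) +
        (4 * J : ℂ) * (star ψ ⬝ᵥ (∑ e ∈ G.edgeFinset,
          Sym2.lift ⟨fun x y => spinBond n 2 x y, fun x y => spinBond_comm n 2 y x⟩ e) *ᵥ ψ) -
        2 * (E : ℂ) * (star ψ ⬝ᵥ ψ) := by
  set P : Op Λ (n + 1) := totalSpin n 0 + I • totalSpin n 1 with hP
  set M : Op Λ (n + 1) := totalSpin n 0 - I • totalSpin n 1 with hM
  set Z : Op Λ (n + 1) := ∑ e ∈ G.edgeFinset,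
    Sym2.lift ⟨fun x y => spinBond n 2 x y, fun x y => spinBond_comm n 2 y x⟩ e with hZ
  have hD := cb4ex_double_commutator n G J
  rw [← hP, ← hM, ← hZ] at hD
  have hexp : (M * (xxzHamiltonian n G J 0 * P - P * xxzHamiltonian n G J 0) -
      (xxzHamiltonian n G J 0 * P - P * xxzHamiltonian n G J 0) * M : Op Λ (n + 1)) =
      M * xxzHamiltonian n G J 0 * P - M * P * xxzHamiltonian n G J 0 -
        xxzHamiltonian n G J 0 * P * M + P * xxzHamiltonian n G J 0 * M := by
    noncomm_ring
  -- pair the f-sum rule against `ψ`, term by term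
  have key := congrArg (fun X : Op Λ (n + 1) => star ψ ⬝ᵥ X *ᵥ ψ) hD
  simp only [hexp, add_mulVec, sub_mulVec, dotProduct_add, dotProduct_sub] at key
  have e1 : star ψ ⬝ᵥ (M * xxzHamiltonian n G J 0 * P) *ᵥ ψ =
      star (P *ᵥ ψ) ⬝ᵥ xxzHamiltonian n G J 0 *ᵥ (P *ᵥ ψ) := by
    rw [← mulVec_mulVec, ← mulVec_mulVec, hM, cb4ex_star_dotProduct_lower_mulVec]
  have e2 : star ψ ⬝ᵥ (M * P * xxzHamiltonian n G J 0) *ᵥ ψ = (E : ℂ) * (star (P *ᵥ ψ) ⬝ᵥ (P *ᵥ ψ)) := by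
    rw [← mulVec_mulVec, ← mulVec_mulVec, hψ, mulVec_smul, mulVec_smul, dotProduct_smul, hM,
      cb4ex_star_dotProduct_lower_mulVec, smul_eq_mul]
  have e3 : star ψ ⬝ᵥ (xxzHamiltonian n G J 0 * P * M) *ᵥ ψ = (E : ℂ) * (star (M *ᵥ ψ) ⬝ᵥ (M *ᵥ ψ)) := by
    rw [← mulVec_mulVec, ← mulVec_mulVec, cb4ex_star_dotProduct_xxz_mulVec n G J hψ, hP,
      cb4ex_star_dotProduct_raise_mulVec]
  have e4 : star ψ ⬝ᵥ (P * xxzHamiltonian n G J 0 * M) *ᵥ ψ =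
      star (M *ᵥ ψ) ⬝ᵥ xxzHamiltonian n G J 0 *ᵥ (M *ᵥ ψ) := by
    rw [← mulVec_mulVec, ← mulVec_mulVec, hP, cb4ex_star_dotProduct_raise_mulVec]
  have e5 : star ψ ⬝ᵥ ((4 * J : ℂ) • Z) *ᵥ ψ = (4 * J : ℂ) * (star ψ ⬝ᵥ Z *ᵥ ψ) := by
    rw [smul_mulVec, dotProduct_smul, smul_eq_mul]
  have e6 : star ψ ⬝ᵥ ((2 : ℂ) • xxzHamiltonian n G J 0) *ᵥ ψ = 2 * (E : ℂ) * (star ψ ⬝ᵥ ψ) := by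
    rw [smul_mulVec, hψ, smul_smul, dotProduct_smul, smul_eq_mul]
  rw [e1, e2, e3, e4, e5, e6] at key
  linear_combination key

/-- **The insertion–removal identity, real parts**:
`Re⟨Ŝ⁺ψ, HŜ⁺ψ⟩ + Re⟨Ŝ⁻ψ, HŜ⁻ψ⟩ = E(‖Ŝ⁺ψ‖² + ‖Ŝ⁻ψ‖²) + 4J Re⟨ψ, Σ Sᶻ_xSᶻ_y ψ⟩ - 2E‖ψ‖²`. [folklore] -/
theorem cb4ex_insertion_removal_identity_re (n : ℕ) (G : SimpleGraph Λ) [DecidableRel G.Adj] (J : ℝ)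
    {ψ : TensorIndex Λ (n + 1) → ℂ} {E : ℝ} (hψ : xxzHamiltonian n G J 0 *ᵥ ψ = (E : ℂ) • ψ) :
    (star ((totalSpin n 0 + I • totalSpin n 1 : Op Λ (n + 1)) *ᵥ ψ) ⬝ᵥ
          xxzHamiltonian n G J 0 *ᵥ ((totalSpin n 0 + I • totalSpin n 1 : Op Λ (n + 1)) *ᵥ ψ)).re +
        (star ((totalSpin n 0 - I • totalSpin n 1 : Op Λ (n + 1)) *ᵥ ψ) ⬝ᵥ
          xxzHamiltonian n G J 0 *ᵥ ((totalSpin n 0 - I • totalSpin n 1 : Op Λ (n + 1)) *ᵥ ψ)).re =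
      E * ((star ((totalSpin n 0 + I • totalSpin n 1 : Op Λ (n + 1)) *ᵥ ψ) ⬝ᵥ
            ((totalSpin n 0 + I • totalSpin n 1 : Op Λ (n + 1)) *ᵥ ψ)).re +
          (star ((totalSpin n 0 - I • totalSpin n 1 : Op Λ (n + 1)) *ᵥ ψ) ⬝ᵥ
            ((totalSpin n 0 - I • totalSpin n 1 : Op Λ (n + 1)) *ᵥ ψ)).re) +
        4 * J * (star ψ ⬝ᵥ (∑ e ∈ G.edgeFinset,
          Sym2.lift ⟨fun x y => spinBond n 2 x y, fun x y => spinBond_comm n 2 y x⟩ e) *ᵥ ψ).re -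
        2 * E * (star ψ ⬝ᵥ ψ).re := by
  have h := congrArg Complex.re (cb4ex_insertion_removal_identity n G J hψ)
  have e1 : ((4 * J : ℂ)) = ((4 * J : ℝ) : ℂ) := by push_cast; ring
  have e2 : (2 * (E : ℂ)) = ((2 * E : ℝ) : ℂ) := by push_cast; ring
  rw [e1, e2] at h
  simp only [Complex.add_re, Complex.sub_re, Complex.re_ofReal_mul] at h
  linarith

/-! ### Registered sub-goal: the f-sum rule on the torus -/

/-- **Registered sub-goal `stub_poExcessBudgetFSum`** (helper of `stub_poExcessBudget`, line
`cosh-budget-penrose-onsager`): the f-sum rule for hard-core bosons on `(ℤ/Lℤ)³`, `L ≥ 3`, over the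
`3L³` site–direction pairs: `[Ŝ⁻, [H, Ŝ⁺]] = -4 Σ_x Σ_i Sᶻ_x Sᶻ_{x+eᵢ} - 2H`, `H = xyTorus 3 L 1`.
[folklore] -/
theorem stub_poExcessBudgetFSum :
    ∀ (L : ℕ) [NeZero L], 3 ≤ L → (totalSpin 1 0 - Complex.I • totalSpin 1 1 : Op (TorusSite 3 L) 2)
      * (xyTorus 3 L 1 * (totalSpin 1 0 + Complex.I • totalSpin 1 1) - (totalSpin 1 0 + Complex.I •
      totalSpin 1 1) * xyTorus 3 L 1) - (xyTorus 3 L 1 * (totalSpin 1 0 + Complex.I • totalSpin 1 1) -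
      (totalSpin 1 0 + Complex.I • totalSpin 1 1) * xyTorus 3 L 1) * (totalSpin 1 0 - Complex.I •
      totalSpin 1 1) = (-4 : ℂ) • (∑ x : TorusSite 3 L, ∑ i : Fin 3, spinBond 1 2 x (x + Pi.single i
      1)) - (2 : ℂ) • xyTorus 3 L 1 := by
  intro L _ hL
  have h := cb4ex_double_commutator 1 (torusGraph 3 L) (-1)
  have hZ := sum_pairs_eq_sum_edgeFinset' (d := 3) L hL
    (fun e => Sym2.lift ⟨fun x y => spinBond 1 2 x y, fun x y => spinBond_comm 1 2 y x⟩ e)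
  simp only [Sym2.lift_mk] at hZ
  rw [← hZ] at h
  have h4 : (4 * ((-1 : ℝ) : ℂ)) = (-4 : ℂ) := by push_cast; ring
  rw [h4] at h
  exact h

end Summit.AtomisticToContinuum.BoseEinsteinCondensation.Cruxes.InsertionFieldDelocalisation.CoshBudgetPenroseOnsager

end
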